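import Summits.HodgeConjecture.HodgeConjecture.Theorems.F0P6aSpecOrgansT
import Summits.HodgeConjecture.HodgeConjecture.Theorems.F0P6aStubFROBRoofGeoWiringAdapters
import Literature.AlgebraicGeometry.GroupSchemes.KernelEqOfLagrangianBlocks
import Literature.AlgebraicGeometry.Resolution.ReducedOfSmoothOverReduced
import Literature.AlgebraicGeometry.Motives.GoodReductionCechProofs
import Literature.AlgebraicGeometry.AbelianSchemes.RoofImageLineCount
import Literature.AlgebraicGeometry.AbelianSchemes.RoofImageLineCountPred
import Literature.AlgebraicGeometry.AbelianSchemes.RoofCoverLegsSourceIso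
import Literature.AlgebraicGeometry.AbelianSchemes.LevelStructureTwist
import Literature.AlgebraicGeometry.Motives.AbelianVarietyTorsionSubschemeEtale
import Literature.AlgebraicGeometry.GroupSchemes.EtaleKernelDecidedOnPoints
import Literature.AlgebraicGeometry.GroupSchemes.EtaleOfTrivialUnitComponent
import Literature.AlgebraicGeometry.GroupSchemes.EtaleKernelOfPointCount
import Literature.AlgebraicGeometry.GroupSchemes.KernelRealisationRank
import Literature.AlgebraicGeometry.AbelianSchemes.WeilDualityPolarizationTransport
import Literature.AlgebraicGeometry.GroupSchemes.AffineGroupSchemeSpecPoints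
import Literature.AlgebraicGeometry.AbelianSchemes.RoofFlatComparisonLegKernel
import HarnessLib
import HarnessLib.Audit.LibrarySuggestionsDenyListCruxes

/-!
# `F0P6aSpecOrgansUBlockJ` — ★ RE-HOME of `Lines/F0_P6a_SpecOrgansU.lean` (tree sha16 c0cd5fc2e87636d7, 1347 l.), PART 1 of 5 — tree lines :1–:366
K6 verbatim twin (L2 column; pen LA2-plan (g5) PLAN v1.3 Δ5 cut set of record [367, 676, 972, 1269]; hand LA2-p02 (g5), `mkparts2.py` cand.v3d1p.LA2-p01g6): the code below this header is the tree bytes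
of the stated range untouched, namespace KEPT (every fully-qualified name unchanged); later parts re-open the scopes live at their first line with their `open` ∕ `variable` ∕
`universe` ∕ section `set_option` lines replayed verbatim (certified by one-file split rehearsal, LA2-p02 TABLE v2∕v3).  Header canonical per LEAD «M-142a» (A): bare imports only.

(d1) CURE (β′) (pen LA2-plan (g5) RULING R3 P1 02:02:52Z 09-03, LEAD «M-142h» (iii′) alias class; twin found by LA3-p02 (g7) 01:26:15Z, L3 box LA3-r01 (g7) 01:51:29Z; re-split by LA2-p01 (g6) with LA2-p02 (g5)՚s `mkparts2.py`, cuts [368, 677, 973, 1270] → [367, 676, 972, 1269]): the tree՚s :81–:85 theorem `hD_of_inputs` (§ HD, (G1) unit pin) — statement AND `variable` frame token-identical to ★ `Summit.HodgeConjecture.HodgeConjecture.Cruxes.HLiu418.F0P6aStubFROBRoofGeoWiring.nonempty_unitHatSlice_iso_of_inputs` [`Theorems/F0P6aStubFROBRoofGeoWiringAdapters`, L3 W4 P2, which lands FIRST] — is RE-EXPORTED BY NAME as `alias hD_of_inputs := …nonempty_unitHatSlice_iso_of_inputs` with that ★ module imported bare, so the FQN `…F0P6aLineSpecialisation.hD_of_inputs`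 survives for its two readers (`Lines/F0_P6a_StubRHO1.lean` :1582 and ★ R5 LAST part) and nothing is asserted twice; `isReduced_total_of_isSmoothProper` stays.  Every other code byte as cand.v2.LA2-p02g5.
## Import provenance — ★ twin stems (LAST part, plain stem) replacing `Cruxes.HLiu418.Lines` imports: `F0P6aSpecOrgansT` ← `Lines.F0_P6a_SpecOrgansT`.
`import HarnessLib.Audit.LibrarySuggestionsDenyListCruxes` kept on this ROOT part per LEAD «M-142d» «P-κ» (parts 2… inherit it); every other import = the tree list made bare
(the trailing provenance comments of 14 import lines stay in the tree file `Lines/F0_P6a_SpecOrgansU.lean` ll. 1–18).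
Original module docstring: reproduced verbatim below this header block (part of the tree bytes :1–:366).  HC_CM is proved only modulo the 7 printed citations (2 remaining: hLiu418 = stmt-HodgeConjecture-24832, h413 = stmt-HodgeConjecture-24833) until rung 0 closes; a re-home is count-neutral.
-/

/-!
# `Lines/F0_P6a_SpecOrgansU.lean` — SPECORGANS PART C, ED. 2 cand v3 (HOME cand, LA2-p01 (g2); assembly only, every block BY COPY of its producer's file of record)

PART C of the organ-bank chain for `stub_SPEC` ∕ `stub_DOWN`: PART A `F0_P6a_SpecOrgans` ED. 2 5d2f0036 (§C §I §G §R; §K = `F0_P6a_RoofKernelCount`, imported) ← PART B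
`F0_P6a_SpecOrgansT` cand v4 8dca47ee (§T5 §Tα §D6 §Q) ← THIS FILE.  CONTENT OF RECORD (LA2-plan (g2) 09:56:28Z (4) «GO», 10:15:26Z (G1) § HD, 11:06:20Z «− §Q»,
11:17:16Z (4) ∕ STATUS #9 (6) «PART C = § HD § J § C6Ω §φ♭ § Jφ; § IMG is its own leaflet `F0_P6a_ImgSection`»).  BLOCKS (each wrapped in `section Block_<k>` with its source's own `open`s;
statements and proofs BYTE-IDENTICAL to the named HOME file):
* § HD — LA2-plan (g2) `HDOfInputs.v1` 987e93b6: `isReduced_total_of_isSmoothProper`, `hD_of_inputs` ((G1): `hD` DERIVED from the inputs; consumed by the `StubRHO1` leaflet);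
* § J — B-p08 (g35) `ImageLine.v4.paid` e9d6ac6d `section ImageLine` MINUS :81–:218 (LA6-p01 (g3) DEDUP MAP ED. 2 v1 44644425: the 12 §K copies; §K is served in RKC);
* § C6Ω — LA6-p01 (g3) BY-IMPORT BLOCK v2 `RoofKernelUnique.partC.v2` 6a7e471b6746df10 (GREEN+TRIO 11:55:56Z, 120 s): `section RoofKernelUnique` of `RoofKernelUnique.v1` 6b8cdcb0 MINUS
  `section QuotWDCore`, §2.0 (:204–:344) AND `section CommGlue` (★-lifted to p851332 `KernelEqOfLagrangianBlocks`; call sites qualified `AffineGroupScheme.…`); `universe u` re-scoped INSIDE the block;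
* §φ♭ — LA2-p03 (g3) `RoofFlat.v2` 8962b883 `section RoofFlat` :400–:573 (= the decl cut of his by-import file `RoofFlat.v3.byimportRKC` 39c0e08c, GREEN+TRIO 10:47:46Z);
* § Jφ — B-p08 (g35) `ImageLine.v4.assembly4.allpaid` 2ecdba42 :1570–:1607, the COMBINED UPSTAIRS HEAD `imgLine_quotΩ_quotΩ_eq_translΩ_assembled` (name «=» LA2-plan 11:06:20Z; consumed by
  the `StubRHO1` leaflet's (IMG) row as `Lb hLb hquot`).
RED duplicates vs PART A ED. 2 ∕ PART B v4 ∕ RKC ∕ LS ED. 3 ∕ KE ∕ KEW ∕ W1-b ∕ QFEI ∕ D-LINE ∕ StubDOWN = 0 (machine census).  Same namespace `…F0P6aLineSpecialisation`;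
imports = PART B + the blocks' ★ additions (all tree).  CODE SORRIES 0; every decl ≤ `maxHeartbeats 400000`.
HC_CM is proved only modulo the 7 printed citations (2 remaining: hLiu418 = stmt-HodgeConjecture-24832, h413 = stmt-HodgeConjecture-24833) until rung 0 closes; count-neutral.
-/

set_option autoImplicit false
set_option linter.dupNamespace false

noncomputable section

namespace Summit.HodgeConjecture.HodgeConjecture.Cruxes.HLiu418.F0P6aLineSpecialisation

/-! ## §HD — § HD (G1) `hD` DERIVED — LA2-plan (g2) `HDOfInputs.v1` 987e93b6020d554b (2 decls, by copy) -/

section Block_HD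

open CategoryTheory CategoryTheory.Limits NumberField IsDedekindDomain MulAction
open scoped Matrix Polynomial Pointwise MonoidalCategory
open Literature.NumberTheory.GaloisRepresentations
open Literature.NumberTheory.Automorphic Literature.NumberTheory.Automorphic.UnitaryGroup
open Literature.AlgebraicGeometry.ShimuraVarieties.UnitaryCanonicalModel
open Literature.NumberTheory.Automorphic.Liu2021.AppendixC
open Literature.AlgebraicGeometry.Motives (AlgPoints IntegralModel SchemeOver thickening)
open Literature.AlgebraicGeometry.RelativeSpec (ActionOver)
open Summit.HodgeConjecture.HodgeConjecture.Cruxes.HLiu418.F0P6aModuliDatumDefs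
open Summit.HodgeConjecture.HodgeConjecture.Cruxes.HLiu418.F0P6aRGDAssembly
open AlgebraicGeometry
open Literature.AlgebraicGeometry.AbelianSchemes Literature.AlgebraicGeometry.AbelianSchemes.AbelianSchemeOver

variable {F : Type} [Field F] [NumberField F] [IsCMField F] {ι₁ : F →+* ℂ}
    {Jstar : Matrix (Fin 2) (Fin 2) F}
    {K₀ : C5.OpenCompactSubgroup ↥(finAdelic ↥(maximalRealSubfield F) F (IsCMField.complexConj F) 2 Jstar)}
    {S : RecordSystemGS F Jstar ι₁ K₀} {hU7ₛ : S.HeckeTranslateDefinedOver}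
    {hJ : (Jstar.map (IsCMField.complexConj F))ᵀ = Jstar} {hJu : IsUnit Jstar}
    {Fi : Type} [Field Fi] [Algebra F Fi] {Kc : C5.SmallLevel K₀} {G : Type} [Group G]
    {𝓜 : IntegralModel (𝓞 F) F ((thickening F Fi).obj (S.M.obj Kc))}
    {w : HeightOneSpectrum (𝓞 F)} {hw : (IsCMField.complexConj F) • w ≠ w} {h𝓨 : (𝓜.localise w).IsSmoothProper 1}
    {θ : ActionOver (𝓜.localise w).total.hom ((Fi ≃ₐ[F] Fi) × G)}
    {e : Fi →ₐ[F] AlgebraicClosure (w.adicCompletion F)}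

/-- (G1) the integral model `𝓨 = (𝓜.localise w).total` is reduced: smooth (`h𝓨.1`) over the DVR `𝒪_(w)` (★ Stacks 034E). -/
theorem isReduced_total_of_isSmoothProper (h𝓨 : (𝓜.localise w).IsSmoothProper 1) :
    IsReduced (𝓜.localise w).total.left := by
  haveI := h𝓨.1
  haveI : Smooth (𝓜.localise w).total.hom := SmoothOfRelativeDimension.smooth 1 _
  haveI := Literature.AlgebraicGeometry.Motives.isDiscreteValuationRing_valuationSubringAtPrime (K := F) (v := w)
  exact Literature.AlgebraicGeometry.Resolution.isReduced_of_smooth_of_isReduced_base (𝓜.localise w).total.hom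

/-- (G1) the model-level unit pin `hD` of ★ kerRows ∕ W1 (b′), DERIVED from the inputs (no socket binder).
RE-EXPORTED BY NAME (tree theorem; nothing new is asserted; gate `dedup.landed`): the statement is ★ `…F0P6aStubFROBRoofGeoWiring.nonempty_unitHatSlice_iso_of_inputs` token for token («M-142h» (iii′); pen LA2-plan (g5) RULING R3 P1 (β′) 02:02:52Z 09-03). -/
alias hD_of_inputs := Summit.HodgeConjecture.HodgeConjecture.Cruxes.HLiu418.F0P6aStubFROBRoofGeoWiring.nonempty_unitHatSlice_iso_of_inputs

end Block_HD

/-! ## §J — § J IMAGE LINE — B-p08 (g35) `ImageLine.v4.paid` e9d6ac6d626e1ad6 `section ImageLine` minus :81–:218 (DEDUP MAP: 12 §K copies dropped; 8 new decls kept) -/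

section Block_J

open CategoryTheory CategoryTheory.Limits NumberField IsDedekindDomain MulAction AlgebraicGeometry
open scoped Matrix Pointwise MonObj
open Literature.NumberTheory.GaloisRepresentations
open Literature.NumberTheory.Automorphic Literature.NumberTheory.Automorphic.UnitaryGroup
open Literature.AlgebraicGeometry.ShimuraVarieties.UnitaryCanonicalModel
open Literature.NumberTheory.Automorphic.Liu2021.AppendixC
open Literature.AlgebraicGeometry.Motives (AlgPoints IntegralModel SchemeOver thickening thickeningLift specOver)
open Literature.NumberTheory.DiophantineGeometry (geomResidueField)
open Literature.AlgebraicGeometry.RelativeSpec (ActionOver)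
open Literature.NumberTheory.EllipticCurves (specGenericPoint)
open Literature.AlgebraicGeometry.AbelianSchemes Literature.AlgebraicGeometry.AbelianSchemes.AbelianSchemeOver
open Summit.HodgeConjecture.HodgeConjecture.Cruxes.HLiu418.F0P6aModuliDatumDefs
open Summit.HodgeConjecture.HodgeConjecture.Cruxes.HLiu418.F0P6aRGDAssembly
open Summit.HodgeConjecture.HodgeConjecture.Cruxes.HLiu418.F0P6aDatumOfInputs
open Summit.HodgeConjecture.HodgeConjecture.Cruxes.HLiu418.F0P6cHeckeBacktrack (exists_line_quotΩ_quotΩ_eq_translΩ_of_hecke_of_hyperspecial)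

section ImageLine

-- the D-line `Letters` frame VERBATIM (upstairs only)
variable {F : Type} [Field F] [NumberField F] [IsCMField F] {ι₁ : F →+* ℂ}
    {Jstar : Matrix (Fin 2) (Fin 2) F}
    {K₀ : C5.OpenCompactSubgroup ↥(finAdelic ↥(maximalRealSubfield F) F (IsCMField.complexConj F) 2 Jstar)}
    {S : RecordSystemGS F Jstar ι₁ K₀} {hU7ₛ : S.HeckeTranslateDefinedOver}
    {hJ : (Jstar.map (IsCMField.complexConj F))ᵀ = Jstar} {hJu : IsUnit Jstar}
    {Fi : Type} [Field Fi] [Algebra F Fi] {Kc : C5.SmallLevel K₀} {G : Type} [Group G]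
    {𝓜 : IntegralModel (𝓞 F) F ((thickening F Fi).obj (S.M.obj Kc))}
    {w : HeightOneSpectrum (𝓞 F)} {hw : (IsCMField.complexConj F) • w ≠ w} {h𝓨 : (𝓜.localise w).IsSmoothProper 1}
    {θ : ActionOver (𝓜.localise w).total.hom ((Fi ≃ₐ[F] Fi) × G)}
    {e : Fi →ₐ[F] AlgebraicClosure (w.adicCompletion F)}


/-! ### §J.pre The `𝒪_F`-action on `A_y` as a ★ `RingAction`, the counts `#A_y[𝔭_w] = #A_y[𝔭_{c•w}] = p^{2f}`, (P-1) at the fibre and `#K = p^{2f}` for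
`RoofLink` kernels — COPY of §K (LA2-p03 (g2) `RoofKernelCount.datum.v3` d2af81f9 :72–:210, token for token; DEDUP AT FOLD: §K precedes §J in `SpecOrgans`, drop these copies) -/



/-! ### §J.0′ `IsIdealTorsionΩ` is a subgroup condition (bookkeeping) -/

/-- `1 ∈ A_y[𝔞](Ω̄)`. [cite: Shimura1998, §7.5 p. 72] -/
theorem isIdealTorsionΩ_one (I : RGDInputsAt F ι₁ Jstar K₀ S hU7ₛ hJ hJu Fi Kc G 𝓜 w hw h𝓨 θ e)
    (y : AlgPoints (S.M.obj Kc) (AlgebraicClosure (w.adicCompletion F))) (𝔞 : Ideal (𝓞 F)) :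
    IsIdealTorsionΩ S Kc 𝓜 w e I.univ I.act y 𝔞 1 :=
  fun a _ => MonObj.one_comp (actΩOf S Kc 𝓜 w e I.univ I.act a y).hom.hom.hom

/-- `A_y[𝔞](Ω̄)` is closed under multiplication. [cite: Shimura1998, §7.5 p. 72] -/
theorem isIdealTorsionΩ_mul (I : RGDInputsAt F ι₁ Jstar K₀ S hU7ₛ hJ hJu Fi Kc G 𝓜 w hw h𝓨 θ e)
    (y : AlgPoints (S.M.obj Kc) (AlgebraicClosure (w.adicCompletion F))) (𝔞 : Ideal (𝓞 F))
    {P Q : (fibreΩOf S Kc 𝓜 w e I.univ y).Points (AlgebraicClosure (w.adicCompletion F))}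
    (hP : IsIdealTorsionΩ S Kc 𝓜 w e I.univ I.act y 𝔞 P) (hQ : IsIdealTorsionΩ S Kc 𝓜 w e I.univ I.act y 𝔞 Q) :
    IsIdealTorsionΩ S Kc 𝓜 w e I.univ I.act y 𝔞 (P * Q) := fun a ha => by
  rw [Literature.AlgebraicGeometry.Motives.AbelianVariety.map_hom_mul, hP a ha, hQ a ha, mul_one]

/-- `A_y[𝔞](Ω̄)` is closed under inverses. [cite: Shimura1998, §7.5 p. 72] -/
theorem isIdealTorsionΩ_inv (I : RGDInputsAt F ι₁ Jstar K₀ S hU7ₛ hJ hJu Fi Kc G 𝓜 w hw h𝓨 θ e)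
    (y : AlgPoints (S.M.obj Kc) (AlgebraicClosure (w.adicCompletion F))) (𝔞 : Ideal (𝓞 F))
    {P : (fibreΩOf S Kc 𝓜 w e I.univ y).Points (AlgebraicClosure (w.adicCompletion F))}
    (hP : IsIdealTorsionΩ S Kc 𝓜 w e I.univ I.act y 𝔞 P) :
    IsIdealTorsionΩ S Kc 𝓜 w e I.univ I.act y 𝔞 P⁻¹ := fun a ha => by
  have h := Literature.AlgebraicGeometry.Motives.AbelianVariety.map_hom_mul (actΩOf S Kc 𝓜 w e I.univ I.act a y) P⁻¹ P
  rw [inv_mul_cancel, hP a ha, isIdealTorsionΩ_one I y 𝔞 a ha] at h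
  exact (eq_inv_of_mul_eq_one_left h.symm).trans inv_one

/-! ### §J.1 The image line of a roof (GENERIC over explicit legs `q`, `c`; no `.choose`) -/

/-- **`imgLineOfRoof I y y″ q c` — THE IMAGE LINE OF THE ROOF `A_y —q→ B ←c— A_{y″}`**: the subgroup of `A_{y″}(Ω̄)` of the points `P″ ∈ A_{y″}[𝔭_{c•w}]` whose
cover image `c P″` is the `q`-image of a `𝔭_{c•w}`-torsion point of `A_y` (the `c•w`-TRANSPORT of `A_y[𝔭_{c•w}]` through the roof; `L♯ = r₁(A_y[𝔭̄])`).  The carrier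
formula is FINAL (A-p06 (g36)'s (IMG) engine reads it through `mem_imgLineOfRoof_iff`); the subgroup axioms are the multiplicativity of `q`, `c`, `ι` on points.
[cite: Liu2021, Prop. D.8 (1)(2) p. 135] [cite: HarrisTaylorAMS2001, §III.4, pp. 108–110] -/
def imgLineOfRoof (I : RGDInputsAt F ι₁ Jstar K₀ S hU7ₛ hJ hJu Fi Kc G 𝓜 w hw h𝓨 θ e)
    (y y'' : AlgPoints (S.M.obj Kc) (AlgebraicClosure (w.adicCompletion F)))
    {B : AbelianSchemeOver (Spec (CommRingCat.of (AlgebraicClosure (w.adicCompletion F))))}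
    (q : (schΩOf S Kc 𝓜 w e I.univ y).X ⟶ B.X) (c : (schΩOf S Kc 𝓜 w e I.univ y'').X ⟶ B.X) [IsMonHom q] [IsMonHom c] :
    Subgroup ((fibreΩOf S Kc 𝓜 w e I.univ y'').Points (AlgebraicClosure (w.adicCompletion F))) where
  carrier := {P'' | IsIdealTorsionΩ S Kc 𝓜 w e I.univ I.act y'' ((IsCMField.complexConj F) • w).asIdeal P'' ∧
    ∃ P : (fibreΩOf S Kc 𝓜 w e I.univ y).Points (AlgebraicClosure (w.adicCompletion F)),
      IsIdealTorsionΩ S Kc 𝓜 w e I.univ I.act y ((IsCMField.complexConj F) • w).asIdeal P ∧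
      (AlgPoints.map c P'' : B.toAffine.toAbelianVariety.Points (AlgebraicClosure (w.adicCompletion F))) = AlgPoints.map q P}
  one_mem' := ⟨isIdealTorsionΩ_one I y'' _, 1, isIdealTorsionΩ_one I y _, (map_pt_one' c).trans (map_pt_one' q).symm⟩
  mul_mem' := fun {P'' Q''} hP hQ => hP.2.elim fun P hP2 => hQ.2.elim fun Q hQ2 =>
    ⟨isIdealTorsionΩ_mul I y'' _ hP.1 hQ.1, P * Q, isIdealTorsionΩ_mul I y _ hP2.1 hQ2.1,
      (map_pt_mul' c P'' Q'').trans ((congrArg₂ (· * ·) hP2.2 hQ2.2).trans (map_pt_mul' q P Q).symm)⟩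
  inv_mem' := fun {P''} hP => hP.2.elim fun P hP2 =>
    ⟨isIdealTorsionΩ_inv I y'' _ hP.1, P⁻¹, isIdealTorsionΩ_inv I y _ hP2.1,
      (map_pt_inv' c P'').trans ((congrArg (·⁻¹) hP2.2).trans (map_pt_inv' q P).symm)⟩

/-- **`mem_imgLineOfRoof_iff`** — membership IS the transport formula (`Iff.rfl`). [cite: Liu2021, Prop. D.8 (1)(2) p. 135] -/
theorem mem_imgLineOfRoof_iff (I : RGDInputsAt F ι₁ Jstar K₀ S hU7ₛ hJ hJu Fi Kc G 𝓜 w hw h𝓨 θ e)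
    (y y'' : AlgPoints (S.M.obj Kc) (AlgebraicClosure (w.adicCompletion F)))
    {B : AbelianSchemeOver (Spec (CommRingCat.of (AlgebraicClosure (w.adicCompletion F))))}
    (q : (schΩOf S Kc 𝓜 w e I.univ y).X ⟶ B.X) (c : (schΩOf S Kc 𝓜 w e I.univ y'').X ⟶ B.X) [IsMonHom q] [IsMonHom c]
    (P'' : (fibreΩOf S Kc 𝓜 w e I.univ y'').Points (AlgebraicClosure (w.adicCompletion F))) :
    P'' ∈ imgLineOfRoof I y y'' q c ↔
      IsIdealTorsionΩ S Kc 𝓜 w e I.univ I.act y'' ((IsCMField.complexConj F) • w).asIdeal P'' ∧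
      ∃ P : (fibreΩOf S Kc 𝓜 w e I.univ y).Points (AlgebraicClosure (w.adicCompletion F)),
        IsIdealTorsionΩ S Kc 𝓜 w e I.univ I.act y ((IsCMField.complexConj F) • w).asIdeal P ∧
        (AlgPoints.map c P'' : B.toAffine.toAbelianVariety.Points (AlgebraicClosure (w.adicCompletion F))) = AlgPoints.map q P :=
  Iff.rfl

set_option maxHeartbeats 400000 in
/-- **(J1) `imgLineOfRoof_isLine` — THE IMAGE LINE IS A LINE AT `y″`**: over the rows (r1) `Ker q(Ω̄) = K`, (r2) `Ker c(Ω̄) = A_{y″}[𝔭_w]`, `c` surjective, (r4) common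
intertwiners of a roof `A_y —q→ B ←c— A_{y″}` and the line clause `L = K ∩ A_y[𝔭_{c•w}]` of a line `L : LineOf I y`: `imgLineOfRoof I y y″ q c` has ORDER `p^f`
(`c|_{A″[𝔭̄]}` is injective since `𝔭_w + 𝔭̄ = 𝒪`; every `q P`, `P ∈ A_y[𝔭̄]`, has a unique `𝔭̄`-torsion `c`-preimage — lift along the points-surjective `c` and
project with `1 = u + v`, `u ∈ 𝔭_w`, `v ∈ 𝔭̄`; so `# = #q(A_y[𝔭̄]) = #A_y[𝔭̄] ∕ #L = p^{2f} ∕ p^f`), lies in `A_{y″}[𝔭̄]` (by definition) and is `𝒪_F`-STABLE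
(`c (ι″(a) P″) = b_a (c P″) = b_a (q P) = q (ι(a) P)`).  ★ p850779 `RoofImageLineCount` at `act := actΩROf I y`, `act″ := actΩROf I y″` (all rows definitionally those of `RoofΩ`). [cite: Liu2021, Prop. D.8 (1)(2) p. 135]
[cite: MumfordAV1970, §7 Thm. 4 (p. 72)] [cite: Shimura1998, §7.5 p. 72] -/
theorem imgLineOfRoof_isLine (I : RGDInputsAt F ι₁ Jstar K₀ S hU7ₛ hJ hJu Fi Kc G 𝓜 w hw h𝓨 θ e)
    (y y'' : AlgPoints (S.M.obj Kc) (AlgebraicClosure (w.adicCompletion F)))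
    {B : AbelianSchemeOver (Spec (CommRingCat.of (AlgebraicClosure (w.adicCompletion F))))}
    (q : (schΩOf S Kc 𝓜 w e I.univ y).X ⟶ B.X) (c : (schΩOf S Kc 𝓜 w e I.univ y'').X ⟶ B.X) [IsMonHom q] [IsMonHom c]
    (K : Subgroup ((fibreΩOf S Kc 𝓜 w e I.univ y).Points (AlgebraicClosure (w.adicCompletion F)))) (L : LineOf I y)
    (hKL : ∀ P, P ∈ L.1 ↔ P ∈ K ∧ IsIdealTorsionΩ S Kc 𝓜 w e I.univ I.act y ((IsCMField.complexConj F) • w).asIdeal P)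
    (h1 : ∀ P : (fibreΩOf S Kc 𝓜 w e I.univ y).Points (AlgebraicClosure (w.adicCompletion F)),
      (AlgPoints.map q P : B.toAffine.toAbelianVariety.Points (AlgebraicClosure (w.adicCompletion F))) = 1 ↔ P ∈ K)
    (h2 : ∀ P : (fibreΩOf S Kc 𝓜 w e I.univ y'').Points (AlgebraicClosure (w.adicCompletion F)),
      (AlgPoints.map c P : B.toAffine.toAbelianVariety.Points (AlgebraicClosure (w.adicCompletion F))) = 1 ↔
        IsIdealTorsionΩ S Kc 𝓜 w e I.univ I.act y'' w.asIdeal P)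
    (h2s : Function.Surjective c.left.base)
    (h4 : ∀ a : 𝓞 F, ∃ b : B.X ⟶ B.X,
      (actΩOf S Kc 𝓜 w e I.univ I.act a y).hom.hom.hom ≫ q = q ≫ b ∧ (actΩOf S Kc 𝓜 w e I.univ I.act a y'').hom.hom.hom ≫ c = c ≫ b) :
    Nat.card ↥(imgLineOfRoof I y y'' q c) = I.pChar ^ I.fDeg ∧
    (∀ P'' ∈ imgLineOfRoof I y y'' q c, IsIdealTorsionΩ S Kc 𝓜 w e I.univ I.act y'' ((IsCMField.complexConj F) • w).asIdeal P'') ∧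
    ∀ (a : 𝓞 F), ∀ P'' ∈ imgLineOfRoof I y y'' q c,
      (AlgPoints.map (actΩOf S Kc 𝓜 w e I.univ I.act a y'').hom.hom.hom P'' :
        (fibreΩOf S Kc 𝓜 w e I.univ y'').Points (AlgebraicClosure (w.adicCompletion F))) ∈ imgLineOfRoof I y y'' q c := by
  -- `𝔭_w + 𝔭_{c•w} = 𝒪_F`
  have hne : w.asIdeal ≠ ((IsCMField.complexConj F) • w).asIdeal := fun h => hw (HeightOneSpectrum.ext h.symm)
  have h𝔭𝔞 : w.asIdeal ⊔ ((IsCMField.complexConj F) • w).asIdeal = ⊤ :=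
    Ideal.IsMaximal.coprime_of_ne w.isMaximal ((IsCMField.complexConj F) • w).isMaximal hne
  refine ⟨?_, fun P'' hP'' => hP''.1, fun a P'' hP'' => ?_⟩
  · -- the count `#Img · #L = #A_y[𝔭̄] = p^{2f}`, `#L = p^f` — through ★ `natCard_imgLine_eq_of_sq_pred` (PREDICATE FORM: the `fibreΩOf`∕`schΩOf`
    -- seam is crossed by points and subtypes only — no `Subgroup`-typed argument, whose `Group` instance the unifier would unfold; daylight head-room cure)
    have hA : Nat.card {P : (fibreΩOf S Kc 𝓜 w e I.univ y).Points (AlgebraicClosure (w.adicCompletion F)) //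
        IsIdealTorsionΩ S Kc 𝓜 w e I.univ I.act y ((IsCMField.complexConj F) • w).asIdeal P} = I.pChar ^ I.fDeg * I.pChar ^ I.fDeg := by
      rw [natCard_idealTorsionΩ_cw_eq I y, ← pow_add, two_mul]
    exact natCard_imgLine_eq_of_sq_pred (actΩROf I y) (actΩROf I y'') q c h𝔭𝔞 (· ∈ K) h1 h2 h2s h4 (· ∈ imgLineOfRoof I y y'' q c)
      (mem_imgLineOfRoof_iff I y y'' q c) (· ∈ L.1) hKL (pow_pos I.hpChar.1.pos _) hA L.2.1
  · -- stability (★ `map_i_imgLine`)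
    refine hP''.2.elim fun P hP => ?_
    have h := map_i_imgLine (actΩROf I y) (actΩROf I y'') q c (((IsCMField.complexConj F) • w).asIdeal) h4 a hP''.1 hP.1 hP.2
    exact ⟨h.1, _, h.2.1, h.2.2⟩

/-! ### §J.2 (U) Roof-target POINT uniqueness upstairs -/

set_option maxHeartbeats 400000 in
/-- **(U) `eq_of_roofΩ_of_roofΩ` — TWO ROOFS FROM `y` THROUGH THE SAME KERNEL READ THE SAME POINT.**  If `A_y —q₁→ B₁ ←c₁— A_{t₁}` and `A_y —q₂→ B₂ ←c₂— A_{t₂}` are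
roofs (`RoofΩ`, cover ideal `𝔭_w`) through one subgroup `K ≤ A_y(Ω̄)`, then `t₁ = t₂`.  PROOF: the legs are isogenies (★ `roof_legs_isFinite_surjective_of_polarization`); `q₁`,
`q₂` have the same kernel on all `T`-points (★ `comp_eq_one_iff_of_forall_points_of_charZero`, étale kernels in characteristic `0`), so ★ `exists_roof_of_roof_of_comp_eq_one_iff`
moves the leg `c₁` to `c₁ ≫ ε : A_{t₁} → B₂` with all its clauses; the common intertwiners of the two legs into `B₂` agree (cancel the epimorphism `q₂`); ★ p850823
`exists_iso_of_two_covers` gives a structured isomorphism `f : A_{t₁} ⥲ A_{t₂}` (exact on `λ`, `ι`, level points — the level clause by `p ∤ N`); ★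
`exists_tupleRel_baseChange_comp_of_iso_of_points` turns it into `tupleIsoAt (genPt … t₁) (genPt … t₂) …`, and (L1) `I.injΩ e t₁ t₂` concludes.
[cite: MumfordAV1970, §7 Thm. 4 (p. 72); §23 Thm. 2 (p. 231)] [cite: MumfordFogartyKirwan1994, Ch. 7 §3 Theorem 7.9 (p. 139)] [cite: Milne2005ShimuraVarieties, §14 pp. 124–125] -/
theorem eq_of_roofΩ_of_roofΩ (I : RGDInputsAt F ι₁ Jstar K₀ S hU7ₛ hJ hJu Fi Kc G 𝓜 w hw h𝓨 θ e) (hpN : Nat.Coprime I.pChar I.N)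
    (y t₁ t₂ : AlgPoints (S.M.obj Kc) (AlgebraicClosure (w.adicCompletion F)))
    (K : Subgroup ((fibreΩOf S Kc 𝓜 w e I.univ y).Points (AlgebraicClosure (w.adicCompletion F))))
    (h₁ : RoofΩ S Kc 𝓜 w e I.univ I.act I.dual I.pol I.lvl I.pChar w.asIdeal y t₁ K)
    (h₂ : RoofΩ S Kc 𝓜 w e I.univ I.act I.dual I.pol I.lvl I.pChar w.asIdeal y t₂ K) :
    t₁ = t₂ := by
  -- ===================== 0. OPEN THE TWO ROOFS; INSTANCES =====================
  obtain ⟨B₁, DB₁, lamB₁, hlamB₁, hDB₁, q₁, hq₁, c₁, hc₁, h1₁, h2₁, h2s₁, h3₁, h3₁'', h4₁, h5₁⟩ := h₁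
  obtain ⟨B₂, DB₂, lamB₂, hlamB₂, hDB₂, q₂, hq₂, c₂, hc₂, h1₂, h2₂, h2s₂, h3₂, h3₂'', h4₂, h5₂⟩ := h₂
  haveI := hlamB₁; haveI := hlamB₂; haveI := hq₁; haveI := hq₂; haveI := hc₁; haveI := hc₂
  have hp0 : I.pChar ≠ 0 := I.hpChar.1.ne_zero
  have hpw : (I.pChar : 𝓞 F) ∈ w.asIdeal := I.hpChar.2
  have hDy := (polΩOf S Kc 𝓜 w e I.univ I.pol y).nonempty_unitHatSlice_iso
  -- the legs are isogenies
  have hlegs₁ := roof_legs_isFinite_surjective_of_polarization (genΩ 𝓜 w) (thickeningLift e (S.M.obj Kc) y).left (thickeningLift e (S.M.obj Kc) t₁).left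
    I.relDim I.act I.dual I.pol DB₁ hDB₁ hDy q₁ c₁ lamB₁ hp0 h3₁ hp0 hpw (fun Pt hPt => (h2₁ Pt).1 hPt) h2s₁
  have hlegs₂ := roof_legs_isFinite_surjective_of_polarization (genΩ 𝓜 w) (thickeningLift e (S.M.obj Kc) y).left (thickeningLift e (S.M.obj Kc) t₂).left
    I.relDim I.act I.dual I.pol DB₂ hDB₂ hDy q₂ c₂ lamB₂ hp0 h3₂ hp0 hpw (fun Pt hPt => (h2₂ Pt).1 hPt) h2s₂
  haveI := hlegs₁.1; haveI := hlegs₁.2.1; haveI := hlegs₂.1; haveI := hlegs₂.2.1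
  -- ===================== 1. THE TWO `q`-LEGS HAVE THE SAME KERNEL ON ALL `T`-POINTS; MOVE `c₁` TO `B₂` =====================
  have hker : ∀ ⦃T : Over (Spec (.of (AlgebraicClosure (w.adicCompletion F))))⦄ (t : T ⟶ (schΩOf S Kc 𝓜 w e I.univ y).X),
      t ≫ q₁ = 1 ↔ t ≫ q₂ = 1 :=
    comp_eq_one_iff_of_forall_points_of_charZero q₁ q₂ fun P => (h1₁ P).trans (h1₂ P).symm
  obtain ⟨ε, hεmon, -, -, hr2, hsurj, hr3, hr4, hr5⟩ :=
    exists_roof_of_roof_of_comp_eq_one_iff (dualΩOf S Kc 𝓜 w e I.univ I.dual y) (dualΩOf S Kc 𝓜 w e I.univ I.dual t₁) DB₁ DB₂ hDB₁ hDB₂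
      (polΩOf S Kc 𝓜 w e I.univ I.pol y).lam (polΩOf S Kc 𝓜 w e I.univ I.pol t₁).lam lamB₁ lamB₂
      (fun a => (actΩOf S Kc 𝓜 w e I.univ I.act a y).hom.hom.hom) (fun a => (actΩOf S Kc 𝓜 w e I.univ I.act a t₁).hom.hom.hom)
      (lvlPtΩOf S Kc 𝓜 w e I.univ I.lvl y) (lvlPtΩOf S Kc 𝓜 w e I.univ I.lvl t₁)
      (IsIdealTorsionΩ S Kc 𝓜 w e I.univ I.act t₁ w.asIdeal) q₁ q₂ c₁ I.pChar hker h3₁ h3₂ h2₁ h2s₁ h3₁'' h4₁ h5₁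
  haveI := hεmon
  -- ===================== 2. THE COMMON INTERTWINERS OF THE TWO LEGS INTO `B₂` AGREE (cancel the epimorphism `q₂`) =====================
  haveI : Flat q₂.left := flat_left_of_isFinite_of_surjective q₂
  choose b' hb'q hb'c using hr4
  choose b hbq hbc using h4₂
  have hbb : ∀ a, b' a = b a := fun a =>
    (schΩOf S Kc 𝓜 w e I.univ y).cancel_left_of_flat_surjective q₂ ((hb'q a).symm.trans (hbq a))
  have h4₁' : ∀ a : 𝓞 F, (actΩROf I t₁).i a ≫ (c₁ ≫ ε.hom) = (c₁ ≫ ε.hom) ≫ b a := fun a => (hbb a) ▸ hb'c a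
  -- ===================== 3. THE STRUCTURED ISOMORPHISM `f : A_{t₁} ⥲ A_{t₂}` (★ p850823) =====================
  haveI : IsCommMonObj I.univ.X := I.comm
  haveI : IsCommMonObj (I.univ.baseChange (genΩ 𝓜 w)).X := isCommMonObj_baseChange _
  have hσN : ∀ (t : AlgPoints (S.M.obj Kc) (AlgebraicClosure (w.adicCompletion F))) (a : Fin I.g ⊕ Fin I.g → ZMod I.N),
      lvlPtΩOf S Kc 𝓜 w e I.univ I.lvl t a ^ I.N = 1 := fun t a =>
    (I.univ.baseChange (genΩ 𝓜 w)).restrictPt_pow_eq_one (thickeningLift e (S.M.obj Kc) t).left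
      ((I.univ.baseChange (genΩ 𝓜 w)).sectionPow_pow_eq_one (I.lvl.baseChange (genΩ 𝓜 w)).pow_σ a)
  obtain ⟨f, hfmon, -, hflam, hfact, hflvl⟩ :=
    exists_iso_of_two_covers (actΩROf I t₁) (actΩROf I t₂)
      (dualΩOf S Kc 𝓜 w e I.univ I.dual t₁) (polΩOf S Kc 𝓜 w e I.univ I.pol t₁)
      (dualΩOf S Kc 𝓜 w e I.univ I.dual t₂) (polΩOf S Kc 𝓜 w e I.univ I.pol t₂) DB₂ lamB₂ (c₁ ≫ ε.hom) c₂
      w.asIdeal w.ne_bot hp0 hpw hDB₂ hr2 hsurj h2₂ h2s₂ hr3 h3₂'' b h4₁' hbc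
      (lvlPtΩOf S Kc 𝓜 w e I.univ I.lvl t₁) (lvlPtΩOf S Kc 𝓜 w e I.univ I.lvl t₂) (fun j => ((hr5 j).symm.trans (h5₂ j)))
      (hσN t₁) (hσN t₂) hpN
  haveI := hfmon
  -- ===================== 4. THE TUPLE ISOMORPHISM AT THE GENERIC POINTS, AND (L1) `injΩ` =====================
  exact I.injΩ e t₁ t₂ (exists_tupleRel_baseChange_comp_of_iso_of_points I.univ I.act I.dual I.pol I.lvl (genΩ 𝓜 w)
    (thickeningLift e (S.M.obj Kc) t₁).left (thickeningLift e (S.M.obj Kc) t₂).left f hflam hflvl hfact)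

/-! ### §J.3 (HC2-img) THE HEAD (φ♭-ROAD) -/

set_option maxHeartbeats 400000 in
/-- **(HC2-img) `exists_imgLine_quotΩ_quotΩ_eq_translΩ` — THE LINE QUOTIENT OF THE LINE QUOTIENT ALONG THE IMAGE LINE IS THE CENTRAL TRANSLATE** (RULED SHAPE (a),
LA2-plan (g2) 08:57:30Z (1) ∕ 09:03:29Z (1); φ♭-ROAD 09:18:21Z): for the opened roof₁ of `hroof y L` and its rows (r1) (r2) (r2-surj) (r4) (the rows (r3) (r5) and the middle's
`DB lamB hDB` are NOT binders here — they are consumed by (H4′-φ♭), whose conclusion enters as `hflat`), `∃ L_b : LineOf I (quotΩ y L)` whose carrier IS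
`imgLineOfRoof I y (quotΩ y L) q c` (first conjunct, `Iff.rfl`) and `quotΩ (quotΩ y L) L_b = translΩ y`.  NAMED INPUTS until paid: (H4′-φ♭) = LA2-p03 (g3) `exists_roofFlat`
conjuncts — `(Kflat) (hflat : RoofΩ … (quotΩ y L) (translΩ y) Kflat) (hVflat : the c•w-part of Kflat IS the image line) (hflat_card : #Kflat = 𝔮·𝔮)`; (C6′-Ω) = LA6-p01 (g3)
`roofKernel_eq_of_cw_eq` AT the point `quotΩ y L` — `(hker_uniq : two RoofΩ kernels at quotΩ y L of order 𝔮·𝔮 with equal c•w-parts are EQUAL)`.  PROOF (sorry-free over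
(J1), (U), §K): `L_b := ⟨imgLineOfRoof …, J1⟩`; `hroof (quotΩ y L) L_b` = roof♯ through `K♯` with `K♯ ∩ A″[𝔭̄] = L_b` and `#K♯ = 𝔮²` (§K `natCard_roofKernel_eq`); `K♯ = Kflat`
(`hker_uniq`, the two c•w-clauses chained through `L_b`); (U) on roof♯ and roof♭.  Consumers: LA1-p01 (g3) (IMG) row of (ρ1𝒞) v3, LA6-p01 (g3) D6, A-p06 (g36) `himg`.
[cite: Liu2021, Prop. D.8 (1)(2) p. 135, pp. 136–138] [cite: HarrisTaylorAMS2001, §III.4, pp. 108–110] [cite: MumfordAV1970, §7 Thm. 4 (p. 72); §23 Thm. 2 (p. 231)] -/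
theorem exists_imgLine_quotΩ_quotΩ_eq_translΩ (I : RGDInputsAt F ι₁ Jstar K₀ S hU7ₛ hJ hJu Fi Kc G 𝓜 w hw h𝓨 θ e) (hpN : Nat.Coprime I.pChar I.N)
    (quotΩ : ∀ y, LineOf I y → AlgPoints (S.M.obj Kc) (AlgebraicClosure (w.adicCompletion F)))
    (translΩ : AlgPoints (S.M.obj Kc) (AlgebraicClosure (w.adicCompletion F)) → AlgPoints (S.M.obj Kc) (AlgebraicClosure (w.adicCompletion F)))
    (hhecke : HeckeClause I quotΩ translΩ)
    (hunit : (UnitaryGroup.isUnit_placeForm Jstar hJu w).unit ∈ glInt 2 (w.adicCompletion F))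
    (hKc : UnitaryGroup.IsHyperspecialAt ↥(maximalRealSubfield F) F (IsCMField.complexConj F) 2 Jstar Kc.1.1
      (w.under (𝓞 ↥(maximalRealSubfield F))))
    (hroof : RoofLink I quotΩ) (hroof₂ : RoofLink₂ I translΩ)
    (y : AlgPoints (S.M.obj Kc) (AlgebraicClosure (w.adicCompletion F))) (L : LineOf I y)
    -- roof₁, OPENED (the witnesses of `hroof y L` as the consumer `obtain`s them)
    (K : Subgroup ((fibreΩOf S Kc 𝓜 w e I.univ y).Points (AlgebraicClosure (w.adicCompletion F))))
    (hKL : ∀ P, P ∈ L.1 ↔ P ∈ K ∧ IsIdealTorsionΩ S Kc 𝓜 w e I.univ I.act y ((IsCMField.complexConj F) • w).asIdeal P)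
    {B : AbelianSchemeOver (Spec (CommRingCat.of (AlgebraicClosure (w.adicCompletion F))))}
    (q : (schΩOf S Kc 𝓜 w e I.univ y).X ⟶ B.X) [IsMonHom q]
    (c : (schΩOf S Kc 𝓜 w e I.univ (quotΩ y L)).X ⟶ B.X) [IsMonHom c]
    (h1 : ∀ P : (fibreΩOf S Kc 𝓜 w e I.univ y).Points (AlgebraicClosure (w.adicCompletion F)),
      (AlgPoints.map q P : B.toAffine.toAbelianVariety.Points (AlgebraicClosure (w.adicCompletion F))) = 1 ↔ P ∈ K)
    (h2 : ∀ P : (fibreΩOf S Kc 𝓜 w e I.univ (quotΩ y L)).Points (AlgebraicClosure (w.adicCompletion F)),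
      (AlgPoints.map c P : B.toAffine.toAbelianVariety.Points (AlgebraicClosure (w.adicCompletion F))) = 1 ↔
        IsIdealTorsionΩ S Kc 𝓜 w e I.univ I.act (quotΩ y L) w.asIdeal P)
    (h2s : Function.Surjective c.left.base)
    (h4 : ∀ a : 𝓞 F, ∃ b : B.X ⟶ B.X,
      (actΩOf S Kc 𝓜 w e I.univ I.act a y).hom.hom.hom ≫ q = q ≫ b ∧ (actΩOf S Kc 𝓜 w e I.univ I.act a (quotΩ y L)).hom.hom.hom ≫ c = c ≫ b)
    -- (H4′-φ♭) THE FLAT ROOF (LA2-p03 (g3) `exists_roofFlat`, conjuncts (a) (b) (d))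
    (Kflat : Subgroup ((fibreΩOf S Kc 𝓜 w e I.univ (quotΩ y L)).Points (AlgebraicClosure (w.adicCompletion F))))
    (hflat : RoofΩ S Kc 𝓜 w e I.univ I.act I.dual I.pol I.lvl I.pChar w.asIdeal (quotΩ y L) (translΩ y) Kflat)
    (hVflat : ∀ P'', (P'' ∈ Kflat ∧ IsIdealTorsionΩ S Kc 𝓜 w e I.univ I.act (quotΩ y L) ((IsCMField.complexConj F) • w).asIdeal P'') ↔
      P'' ∈ imgLineOfRoof I y (quotΩ y L) q c)
    (hflat_card : Nat.card ↥Kflat = I.pChar ^ I.fDeg * I.pChar ^ I.fDeg)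
    -- (C6′-Ω) ROOF-KERNEL UNIQUENESS FROM THE c•w-PART AT `quotΩ y L` (LA6-p01 (g3) `roofKernel_eq_of_cw_eq`)
    (hker_uniq : ∀ (t₁ t₂ : AlgPoints (S.M.obj Kc) (AlgebraicClosure (w.adicCompletion F)))
      (K₁ K₂ : Subgroup ((fibreΩOf S Kc 𝓜 w e I.univ (quotΩ y L)).Points (AlgebraicClosure (w.adicCompletion F)))),
      RoofΩ S Kc 𝓜 w e I.univ I.act I.dual I.pol I.lvl I.pChar w.asIdeal (quotΩ y L) t₁ K₁ →
      RoofΩ S Kc 𝓜 w e I.univ I.act I.dual I.pol I.lvl I.pChar w.asIdeal (quotΩ y L) t₂ K₂ →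
      Nat.card ↥K₁ = I.pChar ^ I.fDeg * I.pChar ^ I.fDeg → Nat.card ↥K₂ = I.pChar ^ I.fDeg * I.pChar ^ I.fDeg →
      (∀ P'', (P'' ∈ K₁ ∧ IsIdealTorsionΩ S Kc 𝓜 w e I.univ I.act (quotΩ y L) ((IsCMField.complexConj F) • w).asIdeal P'') ↔
        (P'' ∈ K₂ ∧ IsIdealTorsionΩ S Kc 𝓜 w e I.univ I.act (quotΩ y L) ((IsCMField.complexConj F) • w).asIdeal P'')) →
      K₁ = K₂) :
    ∃ L_b : LineOf I (quotΩ y L),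
      (∀ P'', P'' ∈ L_b.1 ↔ P'' ∈ imgLineOfRoof I y (quotΩ y L) q c) ∧ quotΩ (quotΩ y L) L_b = translΩ y := by
  have hLsharp := imgLineOfRoof_isLine I y (quotΩ y L) q c K L hKL h1 h2 h2s h4
  refine ⟨⟨imgLineOfRoof I y (quotΩ y L) q c, hLsharp⟩, fun P'' => Iff.rfl, ?_⟩
  -- roof♯ := `hroof (quotΩ y L) L_b` through `K♯`, `#K♯ = 𝔮²` (§K)
  refine (hroof (quotΩ y L) ⟨imgLineOfRoof I y (quotΩ y L) q c, hLsharp⟩).elim fun Ksharp hKsharp => ?_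
  have hcard : Nat.card ↥Ksharp = I.pChar ^ I.fDeg * I.pChar ^ I.fDeg := by
    rw [natCard_roofKernel_eq I quotΩ translΩ hhecke hunit hKc hroof hroof₂ (quotΩ y L) _ Ksharp hKsharp, two_mul, pow_add]
  -- `K♯ = Kflat` by (C6′-Ω): both c•w-parts are the image line
  have hKK : Ksharp = Kflat :=
    hker_uniq _ _ Ksharp Kflat hKsharp.2 hflat hcard hflat_card fun P'' => ((hKsharp.1 P'').symm.trans (hVflat P'').symm)
  -- (U) on roof♯ and roof♭
  have hR : RoofΩ S Kc 𝓜 w e I.univ I.act I.dual I.pol I.lvl I.pChar w.asIdeal (quotΩ y L)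
      (quotΩ (quotΩ y L) ⟨imgLineOfRoof I y (quotΩ y L) q c, hLsharp⟩) Kflat := hKK ▸ hKsharp.2
  exact eq_of_roofΩ_of_roofΩ I hpN (quotΩ y L) _ _ Kflat hR hflat

end ImageLine

end Block_J

end Summit.HodgeConjecture.HodgeConjecture.Cruxes.HLiu418.F0P6aLineSpecialisation

end
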